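import Literature.MathematicalPhysics.QuantumFieldTheory.Balaban1983to89.B1Eq324BenfattoKernelSect5PavementStep
import Literature.MathematicalPhysics.QuantumFieldTheory.Balaban1983to89.B1Eq324BenfattoClassCrossRowMassMoment
import Literature.MathematicalPhysics.QuantumFieldTheory.Balaban1983to89.B1Eq324BenfattoClassCrossRowMass
import HarnessLib

/-!
# `Balaban1983to89.B1Eq324BenfattoKernelSect5ClassRows` — [BenfattoEtAl1978] §5: the HYPOTHESIS ROWS of the class pavement step
# (`…KernelSect5PavementStep.pavementStep`) DISCHARGED at print's pavement from the CLASS CONSTANTS of [Balaban1985BackgroundPropagators]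
# Sect. E p. 428 — one full lower step for the class whose remaining hypotheses are the class constants, the geometry and the per-box bounds, PROVED

statement-level skeleton of published theorems with citation tags; proofs where landed; nothing here is a claim about the
Yang–Mills mass gap

WHY THIS MODULE (cell `pub-ymgap`, seat `dag-n08-d` gen 13, INTENT-58; node N08 [Balaban1985UV3]; the [BenfattoEtAl1978] source chain behind the
(α)-row `h324`; the DEMO of `N08-PORT-MAP-STRUCTURAL-SIDE.md` §2).  `pavementStep` (p610832) carries four analytic rows as hypotheses: the cross-row sums
`hr`/`hrmax`, the budget `hT` and the centre profile `hu`.  This file discharges all four BY NAME at print's pavement for a class kernel given by its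
CONSTANTS: the Combes–Thomas row `Σ_{e′}|A_{ee′}|(cosh(θ·|e−e′|₂) − 1) ≤ J_c` (in the EUCLIDEAN site distance `|·|₂` — a genuine metric; the tree's cube
distance is not one: adjacent cubes are at distance 0), the growth rows `Σ_{e′}e^{−θ|e−e′|₂}(1+|e−e′|₂) ≤ V`, `Σ_{e′}|A_{ee′}|(1+|e−e′|₂) ≤ M`, coercivity `γ_A`,
and the smallness guard `J_c/(cosh(θw) − 1) < γ_A` on the corridor width: `hr`/`hrmax` = seat n08-w5's `…ClassCrossRowMass.cross_rowSum_le_of_class_pavement`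
/ `crossRow_le_rmax` (cube-distance row from the Euclidean one by monotonicity of `cosh`, `cubeDist ≤ |·|₂`); `hT` by definition of the budget (its
|B|·L^d-extensive bound is n08-w5's `…ClassCrossRowMassMoment.sum_crossRow_mul_sq_le_of_class_pavement`); `hu` = `…KernelOfPrecision.abs_condMean_kernel_le_profile`
(J1 F5) at `dist := |·|₂`, `t := γb`, profile `δ := d(Δ_·, I)` (1-Lipschitz for `|·|₂`: n08-w5's `abs_distToRegion_sub_distToRegion_le_sqrt`), so `C_u = VMγ/(γ_A − J_c)`.

WHAT IS PROVED (standard axioms; no `sorry`; no definition).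
* §1 the Euclidean site distance `√Σ_j(x_j − y_j)²` (spelled out, no definition): `l2_self`, `l2_comm`, `l2_triangle`, `l2_nonneg` (the metric axioms J1 F5
  asks); the 1-Lipschitz profile and the Euclidean ⇒ cube-distance row are seat n08-w5's `…ClassCrossRowMassMoment` v1.1 (p613836), consumed by name.
  `exists_labels` (the labelling row `hπ` is always inhabited: each site of `Λ ∖ Γ₁` lies in at most one `shrink L m w`).
* §2 ★★★ `pavementStep_of_classRows` — `…KernelSect5PavementStep.pavementStep` with `r_y := J_c/(cosh(θ·max(w, d(Δ_y, ∪B))) − 1)`,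
  `r_max := J_c/(cosh θw − 1)`, `C_u := VMγ/(γ_A − J_c)`, `T := (1+C_u)²b²Σ_y r_y(1+d(I,y))²` — hypotheses: the class constants `(γ_A, θ, J_c, V, M)`, the guard
  `J_c/(cosh θw − 1) < γ_A`, the pavement inside `Λ` (`L ≥ 1`, `0 < w`, `v ≤ w`, `B ⊇` the tesserae meeting `J`), a labelling `π`, the definitional part-kernel
  rows, the Hamiltonian data, and the per-box LOWER bounds.
HONEST SCOPE.  By-name instantiation of landed rows; the class, the substitute for (5.13) and the bounded-fluctuation device are OURS; the closed-form size
of the price `2(ρ + T/2)` (|B|·L^{d+2}·e^{−θw/2}-shape) is n08-w5's two sum lemmas and is NOT restated here; the per-box bounds remain hypotheses; nothing of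
[Balaban1985UV3] / [Balaban1985UV2] is asserted; no generalised Basic Lemma is stated; the port is not commissioned and nothing is chained; count-neutral for
N08; nothing about d = 4, the continuum, OS axioms, a mass gap or the Clay problem.
-/

noncomputable section

open MeasureTheory ProbabilityTheory Finset Matrix WithLp
open scoped BigOperators Matrix NNReal ENNReal

namespace Literature.MathematicalPhysics.QuantumFieldTheory.Balaban1983to89.B1Eq324BenfattoKernelSect5ClassRows

open Literature.MathematicalPhysics.QuantumFieldTheory
open Literature.MathematicalPhysics.QuantumFieldTheory.GaussianToolkit
open Literature.MathematicalPhysics.QuantumFieldTheory.Balaban1983to89.B1Eq324BenfattoLemma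
open Literature.MathematicalPhysics.QuantumFieldTheory.Balaban1983to89.B1Eq324BenfattoKernelOfPrecision
open Literature.MathematicalPhysics.QuantumFieldTheory.Balaban1983to89.B1Eq324BenfattoKernelSect5PavementStep
open Literature.MathematicalPhysics.QuantumFieldTheory.Balaban1983to89.B1Eq324BenfattoClassCrossRowMass
open Literature.MathematicalPhysics.QuantumFieldTheory.Balaban1983to89.B1Eq324BenfattoClassCrossRowMassMoment (abs_cubeDist_sub_cubeDist_le_sqrt
  abs_distToRegion_sub_distToRegion_le_sqrt rowDefect_cubeDist_le_of_rowDefect_sqrt)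
open Literature.MathematicalPhysics.QuantumFieldTheory.Balaban1983to89.B1Eq324BenfattoAppendixA (distToRegion_nonneg cubeDist_nonneg exists_mem_distToRegion_eq)
open Literature.MathematicalPhysics.QuantumFieldTheory.Balaban1983to89.B1Eq324BenfattoConnLength (cubeDist_comm)
open Literature.MathematicalPhysics.QuantumFieldTheory.Balaban1983to89.B1Eq324BenfattoSect5SlotMoments (cubeDist_self)
open Literature.MathematicalPhysics.QuantumFieldTheory.Balaban1983to89.B1Eq324BenfattoSect5Boxes
open Literature.MathematicalPhysics.QuantumFieldTheory.Balaban1983to89.B1Eq324BenfattoSect5Eq511 (s1Const)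
open Literature.MathematicalPhysics.QuantumFieldTheory.Balaban1983to89.B1Eq324BenfattoSect5Eq524 (psi1p psi2)
open Literature.MathematicalPhysics.QuantumFieldTheory.Balaban1983to89.B1Eq324BenfattoSect5Eq534 (corridorsBar)
open Literature.MathematicalPhysics.QuantumFieldTheory.Balaban1983to89.B1Eq324BenfattoSect5Iteration (restrictCoef)
open Literature.MathematicalPhysics.QuantumFieldTheory.Balaban1983to89.B1Eq324BenfattoSect5Eq515

variable {d : ℕ}

/-! ## §1  The Euclidean site distance: metric axioms, domination of the cube distance, the profile is 1-Lipschitz -/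

section Euclid

/-- kernel: the Euclidean site distance as a norm in `EuclideanSpace`. [folklore] -/
private theorem l2_eq_norm (x y : B1Eq324BenfattoLemma.Site d) :
    Real.sqrt (∑ j, (((x j : ℝ) - (y j : ℝ))) ^ 2) = ‖(WithLp.toLp 2 (fun j => ((x j : ℝ) - (y j : ℝ))) : EuclideanSpace ℝ (Fin d))‖ := by
  rw [EuclideanSpace.norm_eq]
  congr 1
  refine Finset.sum_congr rfl fun j _ => ?_
  rw [show (WithLp.toLp 2 (fun j => ((x j : ℝ) - (y j : ℝ))) : EuclideanSpace ℝ (Fin d)) j = ((x j : ℝ) - (y j : ℝ)) from rfl,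
    Real.norm_eq_abs, sq_abs]

/-- `|x − x|₂ = 0`. [folklore] [cite: BenfattoEtAl1978, after (2.3) p.146] -/
theorem l2_self (x : B1Eq324BenfattoLemma.Site d) : Real.sqrt (∑ j, (((x j : ℝ) - (x j : ℝ))) ^ 2) = 0 := by
  simp

/-- `|x − y|₂ = |y − x|₂`. [folklore] [cite: BenfattoEtAl1978, after (2.3) p.146] -/
theorem l2_comm (x y : B1Eq324BenfattoLemma.Site d) : Real.sqrt (∑ j, (((x j : ℝ) - (y j : ℝ))) ^ 2) = Real.sqrt (∑ j, (((y j : ℝ) - (x j : ℝ))) ^ 2) := by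
  congr 1
  refine Finset.sum_congr rfl fun j _ => ?_
  ring

/-- `|x − y|₂ ≥ 0`. [folklore] [cite: BenfattoEtAl1978, after (2.3) p.146] -/
theorem l2_nonneg (x y : B1Eq324BenfattoLemma.Site d) : 0 ≤ Real.sqrt (∑ j, (((x j : ℝ) - (y j : ℝ))) ^ 2) := Real.sqrt_nonneg _

/-- **The triangle inequality** `|x − z|₂ ≤ |x − y|₂ + |y − z|₂`. [folklore] [cite: BenfattoEtAl1978, after (2.3) p.146] -/
theorem l2_triangle (x y z : B1Eq324BenfattoLemma.Site d) : Real.sqrt (∑ j, (((x j : ℝ) - (z j : ℝ))) ^ 2) ≤ Real.sqrt (∑ j, (((x j : ℝ) - (y j : ℝ))) ^ 2) + Real.sqrt (∑ j, (((y j : ℝ) - (z j : ℝ))) ^ 2) := by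
  rw [l2_eq_norm, l2_eq_norm, l2_eq_norm]
  have h : (WithLp.toLp 2 (fun j => ((x j : ℝ) - (z j : ℝ))) : EuclideanSpace ℝ (Fin d)) =
      (WithLp.toLp 2 (fun j => ((x j : ℝ) - (y j : ℝ))) : EuclideanSpace ℝ (Fin d)) +
        (WithLp.toLp 2 (fun j => ((y j : ℝ) - (z j : ℝ))) : EuclideanSpace ℝ (Fin d)) := by
    ext j
    simp only [PiLp.add_apply]
    show ((x j : ℝ) - (z j : ℝ)) = ((x j : ℝ) - (y j : ℝ)) + ((y j : ℝ) - (z j : ℝ))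
    ring
  rw [h]
  exact norm_add_le _ _


/-- **A part labelling exists**: every site of `Λ ∖ Γ₁` lies in at most one `shrink L m w`, `m ∈ B` (`L ≥ 1`), so there is
`π : ↥(Λ ∖ Γ₁) → Option ↥B` with `π y = some m ↔ y ∈ shrink L m w` (the row `hπ` of the class pavement theorems is always inhabited).
[cite: BenfattoEtAl1978, (5.7)–(5.8) p.154–155] -/
theorem exists_labels {Λ : Finset (B1Eq324BenfattoLemma.Site d)} {L w : ℕ} (hL : 0 < L) (B : Finset (B1Eq324BenfattoLemma.Site d)) :
    ∃ π : ↥(Λ \ corridors L w B) → Option ↥B,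
      ∀ (y : ↥(Λ \ corridors L w B)) (m : ↥B), π y = some m ↔ (y : B1Eq324BenfattoLemma.Site d) ∈ shrink L (m : B1Eq324BenfattoLemma.Site d) w := by
  classical
  refine ⟨fun y => if h : ∃ m : ↥B, (y : B1Eq324BenfattoLemma.Site d) ∈ shrink L (m : B1Eq324BenfattoLemma.Site d) w then some h.choose else none, fun y m => ?_⟩
  dsimp only
  constructor
  · intro hy
    by_cases h : ∃ m : ↥B, (y : B1Eq324BenfattoLemma.Site d) ∈ shrink L (m : B1Eq324BenfattoLemma.Site d) w
    · rw [dif_pos h] at hy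
      have hm : h.choose = m := Option.some_injective _ hy
      rw [← hm]
      exact h.choose_spec
    · rw [dif_neg h] at hy
      exact absurd hy (by simp)
  · intro hy
    have h : ∃ m : ↥B, (y : B1Eq324BenfattoLemma.Site d) ∈ shrink L (m : B1Eq324BenfattoLemma.Site d) w := ⟨m, hy⟩
    rw [dif_pos h]
    congr 1
    by_contra hne
    have hne' : (h.choose : B1Eq324BenfattoLemma.Site d) ≠ (m : B1Eq324BenfattoLemma.Site d) := fun heq => hne (Subtype.ext heq)
    exact Finset.disjoint_left.mp (disjoint_shrink hL hne' w w) h.choose_spec hy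

end Euclid

/-! ## §2  One full lower pavement step for the class, the rows discharged from the class constants -/

section Main

variable {Λ : Finset (B1Eq324BenfattoLemma.Site d)} {A : Matrix Λ Λ ℝ}
  {K : B1Eq324BenfattoLemma.Site d → B1Eq324BenfattoLemma.Site d → ℝ}
  (hK : ∀ x y, K x y = if h : x ∈ Λ ∧ y ∈ Λ then (A⁻¹ : Matrix Λ Λ ℝ) ⟨x, h.1⟩ ⟨y, h.2⟩ else 0)
  {s D : ℕ} {κ : ℝ} {a : Coef d} {J I : Finset (B1Eq324BenfattoLemma.Site d)} {L w v : ℕ} {B : Finset (B1Eq324BenfattoLemma.Site d)}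
  {γ b Ac : ℝ}

include hK

/-- **Centre row of the class, by name** (J1 F5 in the EUCLIDEAN site distance).  For the class kernel `hK` of a symmetric
`γ_A`-coercive `A` on `Λ` with ℓ²-cosh row `Σ_{e′}|A_{ee′}|(cosh(θ|e−e′|₂) − 1) ≤ J_c < γ_A` (`θ ≥ 0`) and growth rows `V`, `M`: for any
conditioning set `Γ ⊆ Λ`, threshold `t ≥ 0` and datum `ξ` with `|ξ_c| ≤ t(1 + d(c, I))` on `Γ`, the conditional mean obeys
`|m^K_{Γ,ξ}(y)| ≤ (VM/(γ_A − J_c))·t·(1 + d(y, I))` at every `y ∈ Λ − Γ`.  The ℓ² pseudometric axioms are `l2_self/l2_comm/l2_triangle`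
and the `1`-Lipschitz property of the profile `d(·, I)` is seat n08-w5's `abs_distToRegion_sub_distToRegion_le_sqrt` (cited, not restated).
[cite: BenfattoEtAl1978, §5 (5.20)–(5.22) p.156 (the translation `u` of (5.21) is `O(b(1+d(Δ,I)))`); Balaban1985BackgroundPropagators, (1.16)–(1.18) p.180 (class form; ours)] -/
theorem abs_condMean_le_of_classRows
    (hAs : ∀ e e', A e e' = A e' e) {γA : ℝ} (hγA0 : 0 < γA)
    (hγA : ∀ x : Λ → ℝ, γA * ∑ e, x e ^ 2 ≤ ∑ e, ∑ e', A e e' * x e * x e')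
    {θ Jc V M : ℝ} (hθ : 0 ≤ θ)
    (hJc : ∀ e : Λ, ∑ e' : Λ, |A e e'| * (Real.cosh (θ * Real.sqrt (∑ j, ((((e : B1Eq324BenfattoLemma.Site d) j : ℝ) - ((e' : B1Eq324BenfattoLemma.Site d) j : ℝ))) ^ 2)) - 1) ≤ Jc)
    (hJcγ : Jc < γA)
    (hV : ∀ e : Λ, ∑ e' : Λ, Real.exp (-(θ * Real.sqrt (∑ j, ((((e : B1Eq324BenfattoLemma.Site d) j : ℝ) - ((e' : B1Eq324BenfattoLemma.Site d) j : ℝ))) ^ 2))) *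
      (1 + Real.sqrt (∑ j, ((((e : B1Eq324BenfattoLemma.Site d) j : ℝ) - ((e' : B1Eq324BenfattoLemma.Site d) j : ℝ))) ^ 2)) ≤ V)
    (hM : ∀ e : Λ, ∑ e' : Λ, |A e e'| * (1 + Real.sqrt (∑ j, ((((e : B1Eq324BenfattoLemma.Site d) j : ℝ) - ((e' : B1Eq324BenfattoLemma.Site d) j : ℝ))) ^ 2)) ≤ M)
    {Γ : Finset (B1Eq324BenfattoLemma.Site d)} (hΓΛ : Γ ⊆ Λ) {t : ℝ} (ht : 0 ≤ t)
    (ξ : B1Eq324BenfattoLemma.Site d → ℝ) (hξ : ∀ c ∈ Γ, |ξ c| ≤ t * (1 + distToRegion I c))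
    {y : B1Eq324BenfattoLemma.Site d} (hyΛ : y ∈ Λ) (hyΓ : y ∉ Γ) :
    |condMean K Γ ξ y| ≤ V * M / (γA - Jc) * t * (1 + distToRegion I y) :=
  abs_condMean_kernel_le_profile hK hAs
    (dist := fun x y : B1Eq324BenfattoLemma.Site d => Real.sqrt (∑ j, (((x j : ℝ) - (y j : ℝ))) ^ 2))
    (fun e => l2_self e) (fun e e' => l2_comm e e') (fun e e' e'' => l2_triangle e e' e'') hγA0 hγA hJc hθ hJcγ hV hM
    (t := t) ht (distToRegion I) (distToRegion_nonneg I)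
    (fun e e' => by
      have h' := (abs_le.mp (abs_distToRegion_sub_distToRegion_le_sqrt I e' e)).2
      have hsymm : Real.sqrt (∑ j, (((e' j : ℝ) - (e j : ℝ))) ^ 2) = Real.sqrt (∑ j, (((e j : ℝ) - (e' j : ℝ))) ^ 2) := l2_comm e' e
      linarith) hΓΛ ξ hξ hyΛ hyΓ

/-- **Centre row `hu` of the LOWER pavement step (`pavementStep`, one event), discharged from the class constants**: for data
`ξ ∈ χ̂^{γb}` on the corridors `Γ₁ ⊆ Λ` (`0 ≤ γ`, `1 ≤ b`), `|m^K_{Γ₁,ξ}(y)| ≤ (VM/(γ_A − J_c))·γ·b·(1 + d(y, I))` on `Λ − Γ₁` — i.e.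
`C_u := VMγ/(γ_A − J_c)`, print's "`u = O(γb)`" of (5.21)–(5.22) for the whole class.
[cite: BenfattoEtAl1978, §5 (5.20)–(5.22) p.156; Balaban1985BackgroundPropagators, (1.16)–(1.18) p.180 (class form; ours)] -/
theorem abs_condMean_corridors_le_of_classRows
    (hAs : ∀ e e', A e e' = A e' e) {γA : ℝ} (hγA0 : 0 < γA)
    (hγA : ∀ x : Λ → ℝ, γA * ∑ e, x e ^ 2 ≤ ∑ e, ∑ e', A e e' * x e * x e')
    {θ Jc V M : ℝ} (hθ : 0 ≤ θ)
    (hJc : ∀ e : Λ, ∑ e' : Λ, |A e e'| * (Real.cosh (θ * Real.sqrt (∑ j, ((((e : B1Eq324BenfattoLemma.Site d) j : ℝ) - ((e' : B1Eq324BenfattoLemma.Site d) j : ℝ))) ^ 2)) - 1) ≤ Jc)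
    (hJcγ : Jc < γA)
    (hV : ∀ e : Λ, ∑ e' : Λ, Real.exp (-(θ * Real.sqrt (∑ j, ((((e : B1Eq324BenfattoLemma.Site d) j : ℝ) - ((e' : B1Eq324BenfattoLemma.Site d) j : ℝ))) ^ 2))) *
      (1 + Real.sqrt (∑ j, ((((e : B1Eq324BenfattoLemma.Site d) j : ℝ) - ((e' : B1Eq324BenfattoLemma.Site d) j : ℝ))) ^ 2)) ≤ V)
    (hM : ∀ e : Λ, ∑ e' : Λ, |A e e'| * (1 + Real.sqrt (∑ j, ((((e : B1Eq324BenfattoLemma.Site d) j : ℝ) - ((e' : B1Eq324BenfattoLemma.Site d) j : ℝ))) ^ 2)) ≤ M)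
    (hγ0 : 0 ≤ γ) (hb : 1 ≤ b) (hΓΛ : corridors L w B ⊆ Λ) :
    ∀ ξ ∈ smallFieldOn (corridors L w B : Set (B1Eq324BenfattoLemma.Site d)) I (γ * b),
      ∀ y ∈ Λ \ corridors L w B, |condMean K (corridors L w B) ξ y| ≤ V * M / (γA - Jc) * γ * b * (1 + distToRegion I y) := by
  intro ξ hξ y hy
  have h := abs_condMean_le_of_classRows hK hAs hγA0 hγA hθ hJc hJcγ hV hM hΓΛ (t := γ * b)
    (mul_nonneg hγ0 (zero_le_one.trans hb)) ξ (fun c hc => hξ c (Finset.mem_coe.mpr hc))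
    (Finset.mem_sdiff.mp hy).1 (Finset.mem_sdiff.mp hy).2
  calc |condMean K (corridors L w B) ξ y| ≤ V * M / (γA - Jc) * (γ * b) * (1 + distToRegion I y) := h
    _ = V * M / (γA - Jc) * γ * b * (1 + distToRegion I y) := by ring

/-- **Centre row `hu` of the CONDITIONAL / UPPER steps (`integral_boxes_factorise_cond_ge/le`, `upperPavementStep_cond_of_setIntegral`;
two events), discharged from the class constants**: for data `ξ` that is `χ̂^{γb}`-small on the corridors `Γ₁` AND `χ̂^{b}`-small on the extra
conditioning set `C` (`C, Γ₁ ⊆ Λ`, `γ ≤ 1 ≤ b`), `|m^K_{C∪Γ₁,ξ}(y)| ≤ (VM/(γ_A − J_c))·b·(1 + d(y, I))` on `Λ − (C ∪ Γ₁)` — i.e.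
`C_u := VM/(γ_A − J_c)` (the datum on `C` is only `b`-small, so no factor `γ` here; print (5.36)).
[cite: BenfattoEtAl1978, §5 (5.20)–(5.22) p.156, (5.36) p.159; Balaban1985BackgroundPropagators, (1.16)–(1.18) p.180 (class form; ours)] -/
theorem abs_condMean_union_le_of_classRows
    (hAs : ∀ e e', A e e' = A e' e) {γA : ℝ} (hγA0 : 0 < γA)
    (hγA : ∀ x : Λ → ℝ, γA * ∑ e, x e ^ 2 ≤ ∑ e, ∑ e', A e e' * x e * x e')
    {θ Jc V M : ℝ} (hθ : 0 ≤ θ)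
    (hJc : ∀ e : Λ, ∑ e' : Λ, |A e e'| * (Real.cosh (θ * Real.sqrt (∑ j, ((((e : B1Eq324BenfattoLemma.Site d) j : ℝ) - ((e' : B1Eq324BenfattoLemma.Site d) j : ℝ))) ^ 2)) - 1) ≤ Jc)
    (hJcγ : Jc < γA)
    (hV : ∀ e : Λ, ∑ e' : Λ, Real.exp (-(θ * Real.sqrt (∑ j, ((((e : B1Eq324BenfattoLemma.Site d) j : ℝ) - ((e' : B1Eq324BenfattoLemma.Site d) j : ℝ))) ^ 2))) *
      (1 + Real.sqrt (∑ j, ((((e : B1Eq324BenfattoLemma.Site d) j : ℝ) - ((e' : B1Eq324BenfattoLemma.Site d) j : ℝ))) ^ 2)) ≤ V)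
    (hM : ∀ e : Λ, ∑ e' : Λ, |A e e'| * (1 + Real.sqrt (∑ j, ((((e : B1Eq324BenfattoLemma.Site d) j : ℝ) - ((e' : B1Eq324BenfattoLemma.Site d) j : ℝ))) ^ 2)) ≤ M)
    (hγ1 : γ ≤ 1) (hb : 1 ≤ b) {C : Finset (B1Eq324BenfattoLemma.Site d)} (hCΛ : C ⊆ Λ) (hΓΛ : corridors L w B ⊆ Λ) :
    ∀ ξ ∈ smallFieldOn (corridors L w B : Set (B1Eq324BenfattoLemma.Site d)) I (γ * b), ξ ∈ smallFieldOn (C : Set (B1Eq324BenfattoLemma.Site d)) I b →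
      ∀ y ∈ Λ \ (C ∪ corridors L w B), |condMean K (C ∪ corridors L w B) ξ y| ≤ V * M / (γA - Jc) * b * (1 + distToRegion I y) := by
  intro ξ hξ hξC y hy
  have hb0 : 0 ≤ b := zero_le_one.trans hb
  refine abs_condMean_le_of_classRows hK hAs hγA0 hγA hθ hJc hJcγ hV hM (Finset.union_subset hCΛ hΓΛ) (t := b) hb0 ξ ?_
    (Finset.mem_sdiff.mp hy).1 (Finset.mem_sdiff.mp hy).2
  intro c hc
  rcases Finset.mem_union.mp hc with hcC | hcΓ
  · exact hξC c (Finset.mem_coe.mpr hcC)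
  · calc |ξ c| ≤ γ * b * (1 + distToRegion I c) := hξ c (Finset.mem_coe.mpr hcΓ)
      _ ≤ b * (1 + distToRegion I c) := by
        have hd : 0 ≤ 1 + distToRegion I c := by have := distToRegion_nonneg I c; linarith
        have : γ * b ≤ b := by nlinarith
        exact mul_le_mul_of_nonneg_right this hd

/-- **ONE FULL LOWER PAVEMENT STEP FOR THE CLASS, THE ANALYTIC ROWS DISCHARGED FROM THE CLASS CONSTANTS.**  For the class kernel `hK` of a symmetric
`γ_A`-coercive precision `A` on `Λ` with EUCLIDEAN Combes–Thomas row `Σ_{e′}|A_{ee′}|(cosh(θ|e−e′|₂) − 1) ≤ J_c < γ_A` (`θ ≥ 0`) and growth rows `V`, `M`;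
print's pavement (`L ≥ 1`, `0 < w`, `v ≤ w`, `Γ₁ ⊆ Λ`, boxes of `B` in `Λ`, `B ⊇` the tesserae meeting `J`) with the corridor-width guard
`J_c/(cosh θw − 1) < γ_A`; a part labelling `π`; the definitional part-kernel rows; `0 ≤ γ ≤ 1 ≤ b`, `J ⊆ I`; the Hamiltonian data; and per-box LOWER bounds
in the part-field currency — then, with `r_y := J_c/(cosh(θ·max(w, d(Δ_y, ∪_{□∈B}□))) − 1)`, `r_max := J_c/(cosh θw − 1)`, `C_u := VMγ/(γ_A − J_c)`,
`T := (1+C_u)²b²Σ_y r_y(1+d(I,y))²`, `ρ := Σ_y r_y/(γ_A − r_max)`: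
`exp(−err₅₁₁ − err₅₃₄ − 2(ρ + T/2) + Σ_□ℓ_□)·∫ Π_Δχ̂^{γb}_Δ e^{H^{A|Γ̄₁}_{J∩Γ̄₁}} dμ_K ≤ ∫ Π_Δχ̂^{b}_Δ e^{H^A_J} dμ_K`.  The size of the price is seat n08-w5's
`sum_crossRow_le_of_class_pavement` / `sum_crossRow_mul_sq_le_of_class_pavement` (|B|·L^d-extensive, `e^{−θw/2}`-small), cited, not restated.
[cite: BenfattoEtAl1978, §5 (5.9)–(5.15) p.155, (5.34)–(5.35) p.159; Appendix C (C.8) p.164 (class substitute at temperature zero; ours)] -/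
theorem pavementStep_of_classRows
    (hAs : ∀ e e', A e e' = A e' e) {γA : ℝ} (hγA0 : 0 < γA)
    (hγA : ∀ x : Λ → ℝ, γA * ∑ e, x e ^ 2 ≤ ∑ e, ∑ e', A e e' * x e * x e')
    {θ Jc V M : ℝ} (hθ : 0 < θ)
    (hJc : ∀ e : Λ, ∑ e' : Λ, |A e e'| * (Real.cosh (θ * Real.sqrt (∑ j, ((((e : B1Eq324BenfattoLemma.Site d) j : ℝ) - ((e' : B1Eq324BenfattoLemma.Site d) j : ℝ))) ^ 2)) - 1) ≤ Jc)
    (hJcγ : Jc < γA)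
    (hV : ∀ e : Λ, ∑ e' : Λ, Real.exp (-(θ * Real.sqrt (∑ j, ((((e : B1Eq324BenfattoLemma.Site d) j : ℝ) - ((e' : B1Eq324BenfattoLemma.Site d) j : ℝ))) ^ 2))) *
      (1 + Real.sqrt (∑ j, ((((e : B1Eq324BenfattoLemma.Site d) j : ℝ) - ((e' : B1Eq324BenfattoLemma.Site d) j : ℝ))) ^ 2)) ≤ V)
    (hM : ∀ e : Λ, ∑ e' : Λ, |A e e'| * (1 + Real.sqrt (∑ j, ((((e : B1Eq324BenfattoLemma.Site d) j : ℝ) - ((e' : B1Eq324BenfattoLemma.Site d) j : ℝ))) ^ 2)) ≤ M)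
    (hκ : 0 < κ) (hJ : CoefSupportedIn a J) (hAc0 : 0 ≤ Ac)
    (hAc : ∀ p ∈ Finset.Icc 1 s, ∀ (Δ : Fin p → B1Eq324BenfattoLemma.Site d), (∀ i, Δ i ∈ J) →
      ∀ n ∈ admissible p D, |a p Δ n| ≤ Ac)
    (hJI : J ⊆ I) (hL : 0 < L) (hw : 0 < w) (hv : v ≤ w) (hγ0 : 0 ≤ γ) (hγ1 : γ ≤ 1) (hb : 1 ≤ b)
    (hΓΛ : corridors L w B ⊆ Λ) (hBΛ : ∀ m ∈ B, box L m ⊆ Λ) (hB : J.image (boxIndex L) ⊆ B)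
    (hguard : Jc / (Real.cosh (θ * w) - 1) < γA)
    (π : ↥(Λ \ corridors L w B) → Option ↥B)
    (hπ : ∀ (y : ↥(Λ \ corridors L w B)) (m : ↥B), π y = some m ↔ (y : B1Eq324BenfattoLemma.Site d) ∈ shrink L (m : B1Eq324BenfattoLemma.Site d) w)
    {Kb : B1Eq324BenfattoLemma.Site d → B1Eq324BenfattoLemma.Site d → B1Eq324BenfattoLemma.Site d → ℝ}
    (hKb : ∀ m (hm : m ∈ B) x y, Kb m x y = if h : x ∈ shrink L m w ∧ y ∈ shrink L m w then
      ((A.submatrix (fun j : ↥(shrink L m w) => (⟨j, hBΛ m hm (shrink_subset_box L m w j.2)⟩ : Λ))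
        (fun j : ↥(shrink L m w) => (⟨j, hBΛ m hm (shrink_subset_box L m w j.2)⟩ : Λ)))⁻¹ :
          Matrix ↥(shrink L m w) ↥(shrink L m w) ℝ) ⟨x, h.1⟩ ⟨y, h.2⟩ else 0)
    {Kout : B1Eq324BenfattoLemma.Site d → B1Eq324BenfattoLemma.Site d → ℝ}
    (hKout : ∀ x y, Kout x y =
      if h : x ∈ ((Λ \ corridors L w B).filter fun x => ∀ m ∈ B, x ∉ box L m) ∧
          y ∈ ((Λ \ corridors L w B).filter fun x => ∀ m ∈ B, x ∉ box L m) then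
        ((A.submatrix
            (fun j : ↥((Λ \ corridors L w B).filter fun x => ∀ m ∈ B, x ∉ box L m) =>
              (⟨j, (Finset.mem_sdiff.mp (Finset.mem_filter.mp j.2).1).1⟩ : Λ))
            (fun j : ↥((Λ \ corridors L w B).filter fun x => ∀ m ∈ B, x ∉ box L m) =>
              (⟨j, (Finset.mem_sdiff.mp (Finset.mem_filter.mp j.2).1).1⟩ : Λ)))⁻¹ :
          Matrix ↥((Λ \ corridors L w B).filter fun x => ∀ m ∈ B, x ∉ box L m)
            ↥((Λ \ corridors L w B).filter fun x => ∀ m ∈ B, x ∉ box L m) ℝ) ⟨x, h.1⟩ ⟨y, h.2⟩ else 0)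
    (ℓ : B1Eq324BenfattoLemma.Site d → ℝ)
    (hbox : ∀ m ∈ B, ∀ ξ : B1Eq324BenfattoLemma.Site d → ℝ, ξ ∈ smallFieldOn (corridors L w B : Set (B1Eq324BenfattoLemma.Site d)) I (γ * b) →
      Real.exp (ℓ m) * ∫ z, (smallFieldOn (frame1 L w m : Set (B1Eq324BenfattoLemma.Site d)) I (γ * b)).indicator (fun _ => (1 : ℝ)) z *
              (smallFieldOn (shrink L m w : Set (B1Eq324BenfattoLemma.Site d)) I b).indicator (fun _ => (1 : ℝ)) z * Real.exp (psi1p s D κ a L w v m z + psi2 s D κ a L w m z) ∂((gaussianFieldOfKernel (Kb m)).map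
              fun (ζ : B1Eq324BenfattoLemma.Site d → ℝ) (x : B1Eq324BenfattoLemma.Site d) => condMean K (corridors L w B) ξ x + ζ x)
        ≤ ∫ z, (smallFieldOn (frame1 L w m : Set (B1Eq324BenfattoLemma.Site d)) I (γ * b)).indicator (fun _ => (1 : ℝ)) z *
              (smallFieldOn (shrink L m w : Set (B1Eq324BenfattoLemma.Site d)) I b).indicator (fun _ => (1 : ℝ)) z * Real.exp (psiBox s D κ a L w m z) ∂((gaussianFieldOfKernel (Kb m)).map
              fun (ζ : B1Eq324BenfattoLemma.Site d → ℝ) (x : B1Eq324BenfattoLemma.Site d) => condMean K (corridors L w B) ξ x + ζ x)) :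
    Real.exp (-(s1Const s D d κ * Ac * b ^ D * Real.exp (-(κ / 4 * w)) * J.card)
        - s1Const s D d κ * Ac * b ^ D *
          (Real.exp (-(κ / 4 * w)) * (corridorsBar L w v B).card + Real.exp (-(κ / 4 * v)) * (B.card * (L : ℝ) ^ d))
        - 2 * ((∑ y : ↥(Λ \ corridors L w B), Jc / (Real.cosh (θ * max (w : ℝ) (distToRegion (B.biUnion (box L)) y)) - 1)) / (γA - Jc / (Real.cosh (θ * w) - 1)) +
          ((1 + V * M / (γA - Jc) * γ) ^ 2 * b ^ 2 *
          ∑ y : ↥(Λ \ corridors L w B), Jc / (Real.cosh (θ * max (w : ℝ) (distToRegion (B.biUnion (box L)) y)) - 1) * (1 + distToRegion I y) ^ 2) / 2) + ∑ m ∈ B, ℓ m) *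
        ∫ z, cutoffBoltzmann (hamiltonian s D κ (restrictCoef a (corridorsBar L w v B)) (J ∩ corridorsBar L w v B)) I (γ * b) z ∂gaussianFieldOfKernel K
      ≤ ∫ z, cutoffBoltzmann (hamiltonian s D κ a J) I b z ∂gaussianFieldOfKernel K := by
  have hJc0 : ∀ y : ↥(Λ \ corridors L w B), 0 ≤ Jc := fun y =>
    le_trans (Finset.sum_nonneg fun e' _ => mul_nonneg (abs_nonneg _) (sub_nonneg.mpr (Real.one_le_cosh _)))
      (hJc ⟨y, (Finset.mem_sdiff.mp y.2).1⟩)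
  have hJcube := fun e => rowDefect_cubeDist_le_of_rowDefect_sqrt hθ.le hJc e
  -- the cross-row rows (seat n08-w5)
  have hr : ∀ y : ↥(Λ \ corridors L w B), ∑ y' : ↥(Λ \ corridors L w B), (if π y = π y' then (0 : ℝ) else
      |A ⟨y, (Finset.mem_sdiff.mp y.2).1⟩ ⟨y', (Finset.mem_sdiff.mp y'.2).1⟩|) ≤
      (fun y : ↥(Λ \ corridors L w B) => Jc / (Real.cosh (θ * max (w : ℝ) (distToRegion (B.biUnion (box L)) y)) - 1)) y := fun y =>
    cross_rowSum_le_of_class_pavement hθ hJcube hL hw B π hπ y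
  have hrmax : ∀ y : ↥(Λ \ corridors L w B), (fun y : ↥(Λ \ corridors L w B) => Jc / (Real.cosh (θ * max (w : ℝ) (distToRegion (B.biUnion (box L)) y)) - 1)) y ≤ Jc / (Real.cosh (θ * w) - 1) := fun y =>
    crossRow_le_rmax hθ (hJc0 y) hw
  -- the budget row, by definition of `T`
  have hT : (1 + V * M / (γA - Jc) * γ) ^ 2 * b ^ 2 *
          ∑ y : ↥(Λ \ corridors L w B), Jc / (Real.cosh (θ * max (w : ℝ) (distToRegion (B.biUnion (box L)) y)) - 1) * (1 + distToRegion I y) ^ 2 ≤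
      (1 + V * M / (γA - Jc) * γ) ^ 2 * b ^ 2 *
          ∑ y : ↥(Λ \ corridors L w B), Jc / (Real.cosh (θ * max (w : ℝ) (distToRegion (B.biUnion (box L)) y)) - 1) * (1 + distToRegion I y) ^ 2 := le_rfl
  -- the centre row (J1 F5 in the Euclidean site distance, profile `d(Δ_·, I)`, datum threshold `γb`)
  have hu := abs_condMean_corridors_le_of_classRows hK hAs hγA0 hγA hθ.le hJc hJcγ hV hM (I := I) hγ0 hb hΓΛ
  exact pavementStep hK hAs hγA0 hγA hJI hL hγ1 hb hΓΛ hBΛ π hπ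
    (fun y : ↥(Λ \ corridors L w B) => Jc / (Real.cosh (θ * max (w : ℝ) (distToRegion (B.biUnion (box L)) y)) - 1)) hr hrmax hguard hKb hKout hu hT
    hκ hJ hAc0 hAc hv hB ℓ hbox

end Main

end Literature.MathematicalPhysics.QuantumFieldTheory.Balaban1983to89.B1Eq324BenfattoKernelSect5ClassRows

end
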